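import Literature.Analysis.FluidPDE.NSRobustnessOfRegularityAgmonParamH1
import Literature.Analysis.FluidPDE.NSRobustnessOfRegularityAgmonParamH2
import Literature.Analysis.FluidPDE.NSRobustnessOfRegularitySupNorm
import HarnessLib

/-!
# Robustness of regularity on `ℝ³`, `AgmonBoundR3` RE-THREAD V: the `H²` window-majorant form and the two
# packaged sup-norm doors, with the Agmon constant as a PARAMETER

Analysis/FluidPDE proof file (theorems only; no definitions, no named facts, no `sorry`); fifth file of the re-thread
of the vein over `(hAg : AgmonBoundR3 A)`. VERBATIM copies of `classicalNS_robustness_H2_strain_window_of_le_R3`,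
`classicalNS_norm_sub_le_strain_window_R3`, `classicalNS_norm_sub_le_strain_window_half_R3`
(`NSRobustnessOfRegularitySupNorm`; RRS 2016 Thm 9.1 / Dashti–Robinson 2008 Thms 1–2 in strain form, read out by
Agmon) with `agmonConst ↦ A` everywhere (`β₁ = A⁴/(2ν³)`, `β₂ = A²μ/ν`, rate `Λ₂`, readout constant); the bricks are
`classicalNS_robustness_strain_window_of_le_of_agmonBound`, `classicalNS_robustness_H2_strain_window_of_agmonBound`,
`norm_le_mul_rpow_of_le_of_agmonBound`.

* `classicalNS_robustness_H2_strain_window_of_le_of_agmonBound`, `classicalNS_norm_sub_le_strain_window_of_agmonBound`,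
  `classicalNS_norm_sub_le_strain_window_half_of_agmonBound`.

WHAT THIS IS NOT: not a statement about Navier–Stokes regularity or blow-up — a-priori calculus between two GIVEN
classical solutions. Consumer: the `H²`-datum door of the hybrid strain road and the smoothing files of the
re-thread; crux 20303 (`EpisodeBaseT`), cell `ns-blowup`.

## References

* J. C. Robinson, J. L. Rodrigo, W. Sadowski, *The Three-Dimensional Navier–Stokes Equations*, CUP 2016,
  Thm 9.1, Thm 1.20. [RobinsonRodrigoSadowskiCUP2016]
* M. Dashti, J. C. Robinson, SIAM J. Numer. Anal. 46 (2008) 3136–3150, Thm 1, Thm 2. [DashtiRobinson2008]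
-/

noncomputable section

open MeasureTheory Set Function Filter Topology InnerProductSpace
open scoped ENNReal NNReal ContDiff RealInnerProductSpace Laplacian

namespace Literature.Analysis.FluidPDE

/-! ## §A Bookkeeping (private copies) -/

/-- Uniform `L²`-Sobolev bounds pass to slicewise differences: if `c(t) = a(t) − b(t)` on `S` with
smooth slices and `a, b` have all `L²` Sobolev norms bounded on `S`, so does `c`. [folklore] -/
private theorem ags_sobolev_sub {F : Type*} [NormedAddCommGroup F] [NormedSpace ℝ F]
    {S : Set ℝ} {a b c : ℝ → EuclideanSpace ℝ (Fin 3) → F}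
    (habc : ∀ t ∈ S, ∀ x, c t x = a t x - b t x) (ha : ∀ t ∈ S, ContDiff ℝ ∞ (a t))
    (hb : ∀ t ∈ S, ContDiff ℝ ∞ (b t))
    (hA : ∀ n : ℕ, ∃ C : ℝ≥0, ∀ t ∈ S, ∫⁻ x, ‖iteratedFDeriv ℝ n (a t) x‖ₑ ^ 2 ≤ C)
    (hB : ∀ n : ℕ, ∃ C : ℝ≥0, ∀ t ∈ S, ∫⁻ x, ‖iteratedFDeriv ℝ n (b t) x‖ₑ ^ 2 ≤ C) (n : ℕ) :
    ∃ C : ℝ≥0, ∀ t ∈ S, ∫⁻ x, ‖iteratedFDeriv ℝ n (c t) x‖ₑ ^ 2 ≤ C := by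
  obtain ⟨Ca, hCa⟩ := hA n
  obtain ⟨Cb, hCb⟩ := hB n
  refine ⟨2 * Ca + 2 * Cb, fun t ht => ?_⟩
  have hc : c t = a t - b t := funext fun x => by rw [Pi.sub_apply, habc t ht x]
  have hsub : ∀ x, iteratedFDeriv ℝ n (c t) x = iteratedFDeriv ℝ n (a t) x - iteratedFDeriv ℝ n (b t) x :=
    fun x => by
      rw [hc]
      exact iteratedFDeriv_sub_apply ((ha t ht).of_le (by exact_mod_cast le_top)).contDiffAt
        ((hb t ht).of_le (by exact_mod_cast le_top)).contDiffAt
  have hm : AEStronglyMeasurable (fun x => iteratedFDeriv ℝ n (a t) x) volume :=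
    ((ha t ht).continuous_iteratedFDeriv (by exact_mod_cast le_top)).aestronglyMeasurable
  calc ∫⁻ x, ‖iteratedFDeriv ℝ n (c t) x‖ₑ ^ 2
      = ∫⁻ x, ‖iteratedFDeriv ℝ n (a t) x - iteratedFDeriv ℝ n (b t) x‖ₑ ^ 2 :=
        lintegral_congr fun x => by rw [hsub]
    _ ≤ 2 * (∫⁻ x, ‖iteratedFDeriv ℝ n (a t) x‖ₑ ^ 2) + 2 * ∫⁻ x, ‖iteratedFDeriv ℝ n (b t) x‖ₑ ^ 2 :=
        lintegral_enorm_sq_sub_le hm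
    _ ≤ 2 * (Ca : ℝ≥0∞) + 2 * (Cb : ℝ≥0∞) := by
        gcongr
        · exact hCa t ht
        · exact hCb t ht
    _ = ((2 * Ca + 2 * Cb : ℝ≥0) : ℝ≥0∞) := by push_cast; rfl

/-- Uniform-in-time Sobolev bound, at one time: `∫⁻‖Dⁿ(c t)‖² < ∞`. [folklore] -/
private theorem ags_fin {F : Type*} [NormedAddCommGroup F] [NormedSpace ℝ F] {S : Set ℝ}
    {c : ℝ → EuclideanSpace ℝ (Fin 3) → F} {t : ℝ} (ht : t ∈ S) (n : ℕ)
    (hC : ∃ C : ℝ≥0, ∀ s ∈ S, ∫⁻ x, ‖iteratedFDeriv ℝ n (c s) x‖ₑ ^ 2 ≤ C) :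
    ∫⁻ x, ‖iteratedFDeriv ℝ n (c t) x‖ₑ ^ 2 < ⊤ := by
  obtain ⟨C, hC⟩ := hC
  exact lt_of_le_of_lt (hC t ht) ENNReal.coe_lt_top

/-! ## §C Window form with majorants of the two defects (the literal certificate shape) -/

section WindowH2Majorants

variable {ν t₀ t₁ : ℝ} {f g u v : ℝ → EuclideanSpace ℝ (Fin 3) → EuclideanSpace ℝ (Fin 3)}
variable {p q : ℝ → EuclideanSpace ℝ (Fin 3) → ℝ}

/-- Monotonicity of the Riccati comparison bound `e^{E}η/(1 − cηs)` in `η`. [folklore] -/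
private theorem ags_riccati_bound_mono {c η η' s E : ℝ} (hc : 0 ≤ c) (hη : 0 ≤ η) (hηη' : η ≤ η')
    (hs : 0 ≤ s) (hpos : 0 < 1 - c * η' * s) :
    Real.exp E * η / (1 - c * η * s) ≤ Real.exp E * η' / (1 - c * η' * s) := by
  have hden : 1 - c * η' * s ≤ 1 - c * η * s := by
    have := mul_le_mul_of_nonneg_right (mul_le_mul_of_nonneg_left hηη' hc) hs
    linarith
  have hpos' : 0 < 1 - c * η * s := hpos.trans_le hden
  have hE := Real.exp_pos E
  calc Real.exp E * η / (1 - c * η * s)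
      ≤ Real.exp E * η' / (1 - c * η * s) :=
        div_le_div_of_nonneg_right (mul_le_mul_of_nonneg_left hηη' hE.le) hpos'.le
    _ ≤ Real.exp E * η' / (1 - c * η' * s) :=
        div_le_div_of_nonneg_left (mul_nonneg hE.le (hη.trans hηη')) hpos hden

/-- **Window form of the `H²` strain theorem with MAJORANTS of the two defects** (the literal
certificate shape): in the setting of `classicalNS_robustness_H2_strain_window_R3`, if
`Z(t₀) ≤ D₂` (datum defect at the `H²` level) and `∫_{t₀}^{t₁} ψ ≤ Ψ₂` (accumulated source),
`η' = D₂ + Ψ₂`, `Λ(t) = ∫_{t₀}^{t} l`, `β = A²μ/ν`, and `βe^{Λ(t₁)}η'(t₁ − t₀) < 1`, then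
`Z(t) ≤ e^{Λ(t)}η'/(1 − βe^{Λ(t₁)}η'(t − t₀))` on `[t₀, t₁]` (the bound is monotone in `η`).
[cite: DashtiRobinson2008, Thm 2 (proof) and Lemma 1] -/
theorem classicalNS_robustness_H2_strain_window_of_le_of_agmonBound {A : ℝ} (hAg : AgmonBoundR3 A) (hν : 0 < ν) (ht₀₁ : t₀ < t₁)
    (hv : IsClassicalNSSolutionOn (Icc t₀ t₁) ν g v q)
    (hu : IsClassicalNSSolutionOn (Icc t₀ t₁) ν f u p)
    (hU : HasBoundedSobolevNormsOn (Icc t₀ t₁) u)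
    (hUt : HasBoundedSobolevNormsOn (Icc t₀ t₁) (timeDerivWithin (Icc t₀ t₁) u))
    (hp : ∀ n : ℕ, ∃ C : ℝ≥0, ∀ t ∈ Icc t₀ t₁, ∫⁻ x, ‖iteratedFDeriv ℝ n (p t) x‖ₑ ^ 2 ≤ C)
    (hV : HasBoundedSobolevNormsOn (Icc t₀ t₁) v)
    (hVt : HasBoundedSobolevNormsOn (Icc t₀ t₁) (timeDerivWithin (Icc t₀ t₁) v))
    (hq : ∀ n : ℕ, ∃ C : ℝ≥0, ∀ t ∈ Icc t₀ t₁, ∫⁻ x, ‖iteratedFDeriv ℝ n (q t) x‖ₑ ^ 2 ≤ C)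
    (hfD : ∀ t ∈ Icc t₀ t₁, ∫⁻ x, ‖fderiv ℝ (f t) x‖ₑ ^ 2 < ⊤)
    (hgD : ∀ t ∈ Icc t₀ t₁, ∫⁻ x, ‖fderiv ℝ (g t) x‖ₑ ^ 2 < ⊤)
    {G σ₂ σ₃ L X₁ H₁ ψ : ℝ → ℝ} {κ μ D₂ Ψ₂ : ℝ} (hκ : 0 < κ) (hμ : 0 < μ)
    (hG : ∀ s ∈ Icc t₀ t₁, ∀ (x ξ : EuclideanSpace ℝ (Fin 3)),
      -⟪fderiv ℝ (u s) x ξ, ξ⟫ ≤ G s * ‖ξ‖ ^ 2)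
    (hσ₂ : ∀ s ∈ Icc t₀ t₁, ∀ x, ‖iteratedFDeriv ℝ 2 (u s) x‖ ≤ σ₂ s)
    (hσ₃ : ∀ s ∈ Icc t₀ t₁, ∀ x, ‖iteratedFDeriv ℝ 3 (u s) x‖ ≤ σ₃ s)
    (hL : ∀ s ∈ Icc t₀ t₁, Real.sqrt (∫ x, ‖(v - u) s x‖ ^ 2) ≤ L s)
    (hX₁ : ∀ s ∈ Icc t₀ t₁, ∫ x, frobeniusNormSq (fderiv ℝ ((v - u) s) x) ≤ X₁ s)
    (hH₁ : ∀ s ∈ Icc t₀ t₁, ∫ x, ‖fderiv ℝ (fun y => f s y - g s y) x‖ ^ 2 ≤ H₁ s)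
    (hψ : ∀ s ∈ Icc t₀ t₁,
      27 * σ₂ s / κ * X₁ s + 9 * σ₃ s / κ ^ 2 * L s ^ 2 + 6 / ν * H₁ s ≤ ψ s)
    (hGc : ContinuousOn G (Icc t₀ t₁)) (hσ₂c : ContinuousOn σ₂ (Icc t₀ t₁))
    (hσ₃c : ContinuousOn σ₃ (Icc t₀ t₁)) (hLc : ContinuousOn L (Icc t₀ t₁))
    (hX₁c : ContinuousOn X₁ (Icc t₀ t₁)) (hH₁c : ContinuousOn H₁ (Icc t₀ t₁))
    (hψc : ContinuousOn ψ (Icc t₀ t₁))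
    (hD₂ : (∑ i, ∫ x, frobeniusNormSq (fderiv ℝ (fun y => fderiv ℝ ((v - u) t₀) y
      (EuclideanSpace.basisFun (Fin 3) ℝ i)) x)) ≤ D₂)
    (hΨ₂ : ∫ s in t₀..t₁, ψ s ≤ Ψ₂)
    (hsmall : A ^ 2 * μ / ν *
        Real.exp (∫ s in t₀..t₁, (6 * G s + 9 * κ * σ₂ s + 3 * κ ^ 2 * σ₃ s +
          3 * A ^ 2 * X₁ s / (ν * μ) + 27 * A ^ 4 * X₁ s ^ 2 / (16 * ν ^ 3))) *
      (D₂ + Ψ₂) * (t₁ - t₀) < 1)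
    {t : ℝ} (ht : t ∈ Icc t₀ t₁) :
    (∑ i, ∫ x, frobeniusNormSq (fderiv ℝ (fun y => fderiv ℝ ((v - u) t) y
        (EuclideanSpace.basisFun (Fin 3) ℝ i)) x)) ≤
      Real.exp (∫ s in t₀..t, (6 * G s + 9 * κ * σ₂ s + 3 * κ ^ 2 * σ₃ s +
          3 * A ^ 2 * X₁ s / (ν * μ) + 27 * A ^ 4 * X₁ s ^ 2 / (16 * ν ^ 3))) *
          (D₂ + Ψ₂) /
        (1 - A ^ 2 * μ / ν *
          Real.exp (∫ s in t₀..t₁, (6 * G s + 9 * κ * σ₂ s + 3 * κ ^ 2 * σ₃ s +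
            3 * A ^ 2 * X₁ s / (ν * μ) + 27 * A ^ 4 * X₁ s ^ 2 / (16 * ν ^ 3))) *
          (D₂ + Ψ₂) * (t - t₀)) := by
  -- abbreviations
  obtain ⟨c, hc⟩ : ∃ c : ℝ, c = A ^ 2 * μ / ν *
      Real.exp (∫ s in t₀..t₁, (6 * G s + 9 * κ * σ₂ s + 3 * κ ^ 2 * σ₃ s +
        3 * A ^ 2 * X₁ s / (ν * μ) + 27 * A ^ 4 * X₁ s ^ 2 / (16 * ν ^ 3))) :=
    ⟨_, rfl⟩
  obtain ⟨η, hη⟩ : ∃ η : ℝ, η = (∑ i, ∫ x, frobeniusNormSq (fderiv ℝ (fun y => fderiv ℝ ((v - u) t₀) y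
      (EuclideanSpace.basisFun (Fin 3) ℝ i)) x)) + ∫ s in t₀..t₁, ψ s := ⟨_, rfl⟩
  have hc0 : 0 ≤ c := by
    rw [hc]
    have := hAg.nonneg
    positivity
  have hZ0 : 0 ≤ ∑ i, ∫ x, frobeniusNormSq (fderiv ℝ (fun y => fderiv ℝ ((v - u) t₀) y
      (EuclideanSpace.basisFun (Fin 3) ℝ i)) x) :=
    Finset.sum_nonneg fun i _ => integral_nonneg fun x => frobeniusNormSq_nonneg _
  have hσ₂0 : ∀ s ∈ Icc t₀ t₁, 0 ≤ σ₂ s := fun s hs => (norm_nonneg _).trans (hσ₂ s hs 0)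
  have hσ₃0 : ∀ s ∈ Icc t₀ t₁, 0 ≤ σ₃ s := fun s hs => (norm_nonneg _).trans (hσ₃ s hs 0)
  have hX₁0 : ∀ s ∈ Icc t₀ t₁, 0 ≤ X₁ s := fun s hs =>
    (integral_nonneg fun x => frobeniusNormSq_nonneg _).trans (hX₁ s hs)
  have hH₁0 : ∀ s ∈ Icc t₀ t₁, 0 ≤ H₁ s := fun s hs =>
    (integral_nonneg fun x => sq_nonneg _).trans (hH₁ s hs)
  have hψ0 : ∀ s ∈ Icc t₀ t₁, 0 ≤ ψ s := fun s hs => by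
    refine le_trans ?_ (hψ s hs)
    have := hσ₂0 s hs; have := hσ₃0 s hs; have := hX₁0 s hs; have := hH₁0 s hs
    positivity
  have hΨ0 : 0 ≤ ∫ s in t₀..t₁, ψ s := intervalIntegral.integral_nonneg ht₀₁.le hψ0
  have hη0 : 0 ≤ η := by rw [hη]; exact add_nonneg hZ0 hΨ0
  have hηη' : η ≤ D₂ + Ψ₂ := by rw [hη]; exact add_le_add hD₂ hΨ₂
  have hT0 : 0 ≤ t₁ - t₀ := sub_nonneg.2 ht₀₁.le
  -- the smallness condition for the exact `η`
  have hsmall' : c * η * (t₁ - t₀) < 1 := by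
    have h1 : c * η * (t₁ - t₀) ≤ c * (D₂ + Ψ₂) * (t₁ - t₀) :=
      mul_le_mul_of_nonneg_right (mul_le_mul_of_nonneg_left hηη' hc0) hT0
    have h2 : c * (D₂ + Ψ₂) * (t₁ - t₀) < 1 := by rw [hc]; exact hsmall
    linarith
  have key := classicalNS_robustness_H2_strain_window_of_agmonBound hAg hν ht₀₁ hv hu hU hUt hp hV hVt hq hfD hgD hκ hμ
    hG hσ₂ hσ₃ hL hX₁ hH₁ hψ hGc hσ₂c hσ₃c hLc hX₁c hH₁c hψc (by rw [← hc, ← hη]; exact hsmall') ht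
  rw [← hc, ← hη] at key
  rw [← hc]
  refine key.trans ?_
  have hpos : 0 < 1 - c * (D₂ + Ψ₂) * (t - t₀) := by
    have h1 : c * (D₂ + Ψ₂) * (t - t₀) ≤ c * (D₂ + Ψ₂) * (t₁ - t₀) :=
      mul_le_mul_of_nonneg_left (sub_le_sub_right ht.2 _) (mul_nonneg hc0 (hη0.trans hηη'))
    have h2 : c * (D₂ + Ψ₂) * (t₁ - t₀) < 1 := by rw [hc]; exact hsmall
    linarith
  exact ags_riccati_bound_mono hc0 hη0 hηη' (sub_nonneg.2 ht.1) hpos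

end WindowH2Majorants


/-! ## §D The packaged sup-norm distance on a window from the `H¹` and `H²` certificates -/

section SupDoor

variable {ν t₀ t₁ : ℝ} {f g u v : ℝ → EuclideanSpace ℝ (Fin 3) → EuclideanSpace ℝ (Fin 3)}
variable {p q : ℝ → EuclideanSpace ℝ (Fin 3) → ℝ}

/-- **Sup-norm distance of two classical solutions on a window from the strain-currency
certificates (a priori; RRS 2016 Thm 9.1 / Dashti–Robinson 2008 Thms 1–2 in strain form, read out
by Agmon).** Let `(u, p)` (force `f`, the reference) and `(v, q)` (force `g`) be classical
solutions on `[t₀, t₁] × ℝ³` in the `L²`-Sobolev class with `Df, Dg ∈ L²` slicewise, and let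
continuous majorants on `[t₀, t₁]` be given: `G` (compression rate of `Du`), `σ₂ ≥ ‖D²u‖_∞`,
`σ₃ ≥ ‖D³u‖_∞`, `L ≥ ‖(v − u)(s)‖_{L²}`, `X₁` and `H₁ ≥ ∫‖D(f − g)(s)‖²`, sources
`ψ₁ ≥ (2/ν)‖f − g‖²_{L²} + 3σ₂L²/κ`, `ψ₂ ≥ 27σ₂X₁/κ + 9σ₃L²/κ² + 6H₁/ν`, defects
`D₁ ≥ ∫|∇(v − u)(t₀)|²_F`, `Ψ₁ ≥ ∫ψ₁`, `D₂ ≥ Z(t₀)`, `Ψ₂ ≥ ∫ψ₂`, where `X₁` dominates the `H¹`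
certificate bound: `e^{Λ₁(s)}(D₁ + Ψ₁)/√(1 − 2β₁e^{2Λ₁(t₁)}(D₁ + Ψ₁)²(s − t₀)) ≤ X₁(s)`
(`Λ₁ = ∫(4G + 3κσ₂)`, `β₁ = A⁴/(2ν³)`). If both smallness conditions hold
(`2β₁e^{2Λ₁(t₁)}(D₁ + Ψ₁)²(t₁ − t₀) < 1`, `β₂e^{Λ₂(t₁)}(D₂ + Ψ₂)(t₁ − t₀) < 1`,
`Λ₂ = ∫(6G + 9κσ₂ + 3κ²σ₃ + 3A²X₁/(νμ) + 27A⁴X₁²/(16ν³))`, `β₂ = A²μ/ν`), then for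
`t ∈ [t₀, t₁]` and every `x`:
`‖v(t,x) − u(t,x)‖ ≤ A·(3·X₁(t)·e^{Λ₂(t)}(D₂ + Ψ₂)/(1 − β₂e^{Λ₂(t₁)}(D₂ + Ψ₂)(t − t₀)))^{1/4}`.
[cite: RobinsonRodrigoSadowskiCUP2016, Thm 9.1 and Thm 1.20; DashtiRobinson2008, Thm 1, Thm 2] -/
theorem classicalNS_norm_sub_le_strain_window_of_agmonBound {A : ℝ} (hAg : AgmonBoundR3 A) (hν : 0 < ν) (ht₀₁ : t₀ < t₁)
    (hv : IsClassicalNSSolutionOn (Icc t₀ t₁) ν g v q)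
    (hu : IsClassicalNSSolutionOn (Icc t₀ t₁) ν f u p)
    (hU : HasBoundedSobolevNormsOn (Icc t₀ t₁) u)
    (hUt : HasBoundedSobolevNormsOn (Icc t₀ t₁) (timeDerivWithin (Icc t₀ t₁) u))
    (hp : ∀ n : ℕ, ∃ C : ℝ≥0, ∀ t ∈ Icc t₀ t₁, ∫⁻ x, ‖iteratedFDeriv ℝ n (p t) x‖ₑ ^ 2 ≤ C)
    (hV : HasBoundedSobolevNormsOn (Icc t₀ t₁) v)
    (hVt : HasBoundedSobolevNormsOn (Icc t₀ t₁) (timeDerivWithin (Icc t₀ t₁) v))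
    (hq : ∀ n : ℕ, ∃ C : ℝ≥0, ∀ t ∈ Icc t₀ t₁, ∫⁻ x, ‖iteratedFDeriv ℝ n (q t) x‖ₑ ^ 2 ≤ C)
    (hfD : ∀ t ∈ Icc t₀ t₁, ∫⁻ x, ‖fderiv ℝ (f t) x‖ₑ ^ 2 < ⊤)
    (hgD : ∀ t ∈ Icc t₀ t₁, ∫⁻ x, ‖fderiv ℝ (g t) x‖ₑ ^ 2 < ⊤)
    {G σ₂ σ₃ L X₁ H₁ ψ₁ ψ₂ : ℝ → ℝ} {κ μ D₁ Ψ₁ D₂ Ψ₂ : ℝ} (hκ : 0 < κ) (hμ : 0 < μ)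
    (hG : ∀ s ∈ Icc t₀ t₁, ∀ (x ξ : EuclideanSpace ℝ (Fin 3)),
      -⟪fderiv ℝ (u s) x ξ, ξ⟫ ≤ G s * ‖ξ‖ ^ 2)
    (hσ₂ : ∀ s ∈ Icc t₀ t₁, ∀ x, ‖iteratedFDeriv ℝ 2 (u s) x‖ ≤ σ₂ s)
    (hσ₃ : ∀ s ∈ Icc t₀ t₁, ∀ x, ‖iteratedFDeriv ℝ 3 (u s) x‖ ≤ σ₃ s)
    (hL : ∀ s ∈ Icc t₀ t₁, Real.sqrt (∫ x, ‖(v - u) s x‖ ^ 2) ≤ L s)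
    (hH₁ : ∀ s ∈ Icc t₀ t₁, ∫ x, ‖fderiv ℝ (fun y => f s y - g s y) x‖ ^ 2 ≤ H₁ s)
    (hψ₁ : ∀ s ∈ Icc t₀ t₁, 2 / ν * (∫ x, ‖f s x - g s x‖ ^ 2) + 3 * σ₂ s / κ * L s ^ 2 ≤ ψ₁ s)
    (hψ₂ : ∀ s ∈ Icc t₀ t₁,
      27 * σ₂ s / κ * X₁ s + 9 * σ₃ s / κ ^ 2 * L s ^ 2 + 6 / ν * H₁ s ≤ ψ₂ s)
    (hGc : ContinuousOn G (Icc t₀ t₁)) (hσ₂c : ContinuousOn σ₂ (Icc t₀ t₁))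
    (hσ₃c : ContinuousOn σ₃ (Icc t₀ t₁)) (hLc : ContinuousOn L (Icc t₀ t₁))
    (hX₁c : ContinuousOn X₁ (Icc t₀ t₁)) (hH₁c : ContinuousOn H₁ (Icc t₀ t₁))
    (hψ₁c : ContinuousOn ψ₁ (Icc t₀ t₁)) (hψ₂c : ContinuousOn ψ₂ (Icc t₀ t₁))
    (hD₁ : ∫ x, frobeniusNormSq (fderiv ℝ ((v - u) t₀) x) ≤ D₁)
    (hΨ₁ : ∫ s in t₀..t₁, ψ₁ s ≤ Ψ₁)
    (hD₂ : (∑ i, ∫ x, frobeniusNormSq (fderiv ℝ (fun y => fderiv ℝ ((v - u) t₀) y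
      (EuclideanSpace.basisFun (Fin 3) ℝ i)) x)) ≤ D₂)
    (hΨ₂ : ∫ s in t₀..t₁, ψ₂ s ≤ Ψ₂)
    (hsmall₁ : 2 * (A ^ 4 / (2 * ν ^ 3) *
        Real.exp (2 * ∫ s in t₀..t₁, (4 * G s + 3 * κ * σ₂ s))) * (D₁ + Ψ₁) ^ 2 * (t₁ - t₀) < 1)
    (hX₁ : ∀ s ∈ Icc t₀ t₁,
      Real.exp (∫ r in t₀..s, (4 * G r + 3 * κ * σ₂ r)) * (D₁ + Ψ₁) /
        Real.sqrt (1 - 2 * (A ^ 4 / (2 * ν ^ 3) *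
            Real.exp (2 * ∫ r in t₀..t₁, (4 * G r + 3 * κ * σ₂ r))) * (D₁ + Ψ₁) ^ 2 * (s - t₀)) ≤
        X₁ s)
    (hsmall₂ : A ^ 2 * μ / ν *
        Real.exp (∫ s in t₀..t₁, (6 * G s + 9 * κ * σ₂ s + 3 * κ ^ 2 * σ₃ s +
          3 * A ^ 2 * X₁ s / (ν * μ) + 27 * A ^ 4 * X₁ s ^ 2 / (16 * ν ^ 3))) *
      (D₂ + Ψ₂) * (t₁ - t₀) < 1)
    {t : ℝ} (ht : t ∈ Icc t₀ t₁) (x : EuclideanSpace ℝ (Fin 3)) :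
    ‖v t x - u t x‖ ≤ A * (3 * X₁ t *
      (Real.exp (∫ s in t₀..t, (6 * G s + 9 * κ * σ₂ s + 3 * κ ^ 2 * σ₃ s +
          3 * A ^ 2 * X₁ s / (ν * μ) + 27 * A ^ 4 * X₁ s ^ 2 / (16 * ν ^ 3))) *
          (D₂ + Ψ₂) /
        (1 - A ^ 2 * μ / ν *
          Real.exp (∫ s in t₀..t₁, (6 * G s + 9 * κ * σ₂ s + 3 * κ ^ 2 * σ₃ s +
            3 * A ^ 2 * X₁ s / (ν * μ) + 27 * A ^ 4 * X₁ s ^ 2 / (16 * ν ^ 3))) *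
          (D₂ + Ψ₂) * (t - t₀)))) ^ (1 / 4 : ℝ) := by
  -- the `H¹` level along the window, dominated by `X₁`
  have hH1 : ∀ s ∈ Icc t₀ t₁, ∫ x, frobeniusNormSq (fderiv ℝ ((v - u) s) x) ≤ X₁ s := fun s hs =>
    (classicalNS_robustness_strain_window_of_le_of_agmonBound hAg hν ht₀₁ hv hu hU hUt hp hV hVt hq hκ hG hσ₂ hL hψ₁
      hGc hσ₂c hψ₁c hD₁ hΨ₁ hsmall₁ hs).trans (hX₁ s hs)
  -- the `H²` level at `t`
  have hH2 := classicalNS_robustness_H2_strain_window_of_le_of_agmonBound hAg hν ht₀₁ hv hu hU hUt hp hV hVt hq hfD hgD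
    hκ hμ hG hσ₂ hσ₃ hL hH1 hH₁ hψ₂ hGc hσ₂c hσ₃c hLc hX₁c hH₁c hψ₂c hD₂ hΨ₂ hsmall₂ ht
  -- the readout
  have hwsm : IsSmoothSpaceTimeOn (Icc t₀ t₁) (v - u) := hv.smooth_velocity.sub hu.smooth_velocity
  have hwsob : HasBoundedSobolevNormsOn (Icc t₀ t₁) (v - u) :=
    ags_sobolev_sub (fun s _ x => rfl) (fun s hs => hv.contDiff_velocity hs)
      (fun s hs => hu.contDiff_velocity hs) hV hU
  have h := norm_le_mul_rpow_of_le_of_agmonBound hAg (hwsm.contDiff_slice ht)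
    (fun n => ags_fin ht n (hwsob n)) (hH1 t ht) hH2 x
  simpa only [Pi.sub_apply] using h

end SupDoor

/-! ## §E The packaged door under half-smallness: closed-form sup bound -/

section SupDoorSimple

variable {ν t₀ t₁ : ℝ} {f g u v : ℝ → EuclideanSpace ℝ (Fin 3) → EuclideanSpace ℝ (Fin 3)}
variable {p q : ℝ → EuclideanSpace ℝ (Fin 3) → ℝ}

/-- **The packaged sup-norm door with HALF-smallness, closed form** (the readable price): in the
setting of `classicalNS_norm_sub_le_strain_window_R3`, if the two smallness products are at most
`1/2` (`2β₁e^{2Λ₁(t₁)}(D₁ + Ψ₁)²(t₁ − t₀) ≤ 1/2`, `β₂e^{Λ₂(t₁)}(D₂ + Ψ₂)(t₁ − t₀) ≤ 1/2`) and the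
continuous `X₁` dominates `√2·e^{Λ₁(s)}(D₁ + Ψ₁)` on `[t₀, t₁]`, then for `t ∈ [t₀, t₁]` and
every `x`: `‖v(t,x) − u(t,x)‖ ≤ A(3X₁(t)·2e^{Λ₂(t)}(D₂ + Ψ₂))^{1/4}` — i.e. the sup distance is at
most `A·6^{1/4}·(X₁(t)e^{Λ₂(t)}(D₂ + Ψ₂))^{1/4}`, fee `e^{(Λ₁ + Λ₂)/4}` in strain times, defects
entering through fourth roots. [cite: RobinsonRodrigoSadowskiCUP2016, Thm 9.1 and Thm 1.20; DashtiRobinson2008, Thm 1, Thm 2] -/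
theorem classicalNS_norm_sub_le_strain_window_half_of_agmonBound {A : ℝ} (hAg : AgmonBoundR3 A) (hν : 0 < ν) (ht₀₁ : t₀ < t₁)
    (hv : IsClassicalNSSolutionOn (Icc t₀ t₁) ν g v q)
    (hu : IsClassicalNSSolutionOn (Icc t₀ t₁) ν f u p)
    (hU : HasBoundedSobolevNormsOn (Icc t₀ t₁) u)
    (hUt : HasBoundedSobolevNormsOn (Icc t₀ t₁) (timeDerivWithin (Icc t₀ t₁) u))
    (hp : ∀ n : ℕ, ∃ C : ℝ≥0, ∀ t ∈ Icc t₀ t₁, ∫⁻ x, ‖iteratedFDeriv ℝ n (p t) x‖ₑ ^ 2 ≤ C)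
    (hV : HasBoundedSobolevNormsOn (Icc t₀ t₁) v)
    (hVt : HasBoundedSobolevNormsOn (Icc t₀ t₁) (timeDerivWithin (Icc t₀ t₁) v))
    (hq : ∀ n : ℕ, ∃ C : ℝ≥0, ∀ t ∈ Icc t₀ t₁, ∫⁻ x, ‖iteratedFDeriv ℝ n (q t) x‖ₑ ^ 2 ≤ C)
    (hfD : ∀ t ∈ Icc t₀ t₁, ∫⁻ x, ‖fderiv ℝ (f t) x‖ₑ ^ 2 < ⊤)
    (hgD : ∀ t ∈ Icc t₀ t₁, ∫⁻ x, ‖fderiv ℝ (g t) x‖ₑ ^ 2 < ⊤)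
    {G σ₂ σ₃ L X₁ H₁ ψ₁ ψ₂ : ℝ → ℝ} {κ μ D₁ Ψ₁ D₂ Ψ₂ : ℝ} (hκ : 0 < κ) (hμ : 0 < μ)
    (hG : ∀ s ∈ Icc t₀ t₁, ∀ (x ξ : EuclideanSpace ℝ (Fin 3)),
      -⟪fderiv ℝ (u s) x ξ, ξ⟫ ≤ G s * ‖ξ‖ ^ 2)
    (hσ₂ : ∀ s ∈ Icc t₀ t₁, ∀ x, ‖iteratedFDeriv ℝ 2 (u s) x‖ ≤ σ₂ s)
    (hσ₃ : ∀ s ∈ Icc t₀ t₁, ∀ x, ‖iteratedFDeriv ℝ 3 (u s) x‖ ≤ σ₃ s)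
    (hL : ∀ s ∈ Icc t₀ t₁, Real.sqrt (∫ x, ‖(v - u) s x‖ ^ 2) ≤ L s)
    (hH₁ : ∀ s ∈ Icc t₀ t₁, ∫ x, ‖fderiv ℝ (fun y => f s y - g s y) x‖ ^ 2 ≤ H₁ s)
    (hψ₁ : ∀ s ∈ Icc t₀ t₁, 2 / ν * (∫ x, ‖f s x - g s x‖ ^ 2) + 3 * σ₂ s / κ * L s ^ 2 ≤ ψ₁ s)
    (hψ₂ : ∀ s ∈ Icc t₀ t₁,
      27 * σ₂ s / κ * X₁ s + 9 * σ₃ s / κ ^ 2 * L s ^ 2 + 6 / ν * H₁ s ≤ ψ₂ s)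
    (hGc : ContinuousOn G (Icc t₀ t₁)) (hσ₂c : ContinuousOn σ₂ (Icc t₀ t₁))
    (hσ₃c : ContinuousOn σ₃ (Icc t₀ t₁)) (hLc : ContinuousOn L (Icc t₀ t₁))
    (hX₁c : ContinuousOn X₁ (Icc t₀ t₁)) (hH₁c : ContinuousOn H₁ (Icc t₀ t₁))
    (hψ₁c : ContinuousOn ψ₁ (Icc t₀ t₁)) (hψ₂c : ContinuousOn ψ₂ (Icc t₀ t₁))
    (hD₁ : ∫ x, frobeniusNormSq (fderiv ℝ ((v - u) t₀) x) ≤ D₁)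
    (hΨ₁ : ∫ s in t₀..t₁, ψ₁ s ≤ Ψ₁)
    (hD₂ : (∑ i, ∫ x, frobeniusNormSq (fderiv ℝ (fun y => fderiv ℝ ((v - u) t₀) y
      (EuclideanSpace.basisFun (Fin 3) ℝ i)) x)) ≤ D₂)
    (hΨ₂ : ∫ s in t₀..t₁, ψ₂ s ≤ Ψ₂)
    (hhalf₁ : 2 * (A ^ 4 / (2 * ν ^ 3) *
        Real.exp (2 * ∫ s in t₀..t₁, (4 * G s + 3 * κ * σ₂ s))) * (D₁ + Ψ₁) ^ 2 * (t₁ - t₀) ≤ 1 / 2)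
    (hX₁ : ∀ s ∈ Icc t₀ t₁,
      Real.sqrt 2 * (Real.exp (∫ r in t₀..s, (4 * G r + 3 * κ * σ₂ r)) * (D₁ + Ψ₁)) ≤ X₁ s)
    (hhalf₂ : A ^ 2 * μ / ν *
        Real.exp (∫ s in t₀..t₁, (6 * G s + 9 * κ * σ₂ s + 3 * κ ^ 2 * σ₃ s +
          3 * A ^ 2 * X₁ s / (ν * μ) + 27 * A ^ 4 * X₁ s ^ 2 / (16 * ν ^ 3))) *
      (D₂ + Ψ₂) * (t₁ - t₀) ≤ 1 / 2)
    {t : ℝ} (ht : t ∈ Icc t₀ t₁) (x : EuclideanSpace ℝ (Fin 3)) :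
    ‖v t x - u t x‖ ≤ A * (3 * X₁ t *
      (2 * (Real.exp (∫ s in t₀..t, (6 * G s + 9 * κ * σ₂ s + 3 * κ ^ 2 * σ₃ s +
          3 * A ^ 2 * X₁ s / (ν * μ) + 27 * A ^ 4 * X₁ s ^ 2 / (16 * ν ^ 3))) *
        (D₂ + Ψ₂)))) ^ (1 / 4 : ℝ) := by
  -- abbreviations
  obtain ⟨c₁, hc₁⟩ : ∃ c₁ : ℝ, c₁ = 2 * (A ^ 4 / (2 * ν ^ 3) *
      Real.exp (2 * ∫ s in t₀..t₁, (4 * G s + 3 * κ * σ₂ s))) := ⟨_, rfl⟩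
  obtain ⟨c₂, hc₂⟩ : ∃ c₂ : ℝ, c₂ = A ^ 2 * μ / ν *
      Real.exp (∫ s in t₀..t₁, (6 * G s + 9 * κ * σ₂ s + 3 * κ ^ 2 * σ₃ s +
        3 * A ^ 2 * X₁ s / (ν * μ) + 27 * A ^ 4 * X₁ s ^ 2 / (16 * ν ^ 3))) :=
    ⟨_, rfl⟩
  have hA0 : 0 ≤ A := hAg.nonneg
  have hc₁0 : 0 ≤ c₁ := by rw [hc₁]; positivity
  have hc₂0 : 0 ≤ c₂ := by rw [hc₂]; positivity
  rw [← hc₁] at hhalf₁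
  rw [← hc₂] at hhalf₂
  have hT0 : 0 < t₁ - t₀ := sub_pos.2 ht₀₁
  -- signs of the two defect totals
  have hσ₂0 : ∀ s ∈ Icc t₀ t₁, 0 ≤ σ₂ s := fun s hs => (norm_nonneg _).trans (hσ₂ s hs 0)
  have hσ₃0 : ∀ s ∈ Icc t₀ t₁, 0 ≤ σ₃ s := fun s hs => (norm_nonneg _).trans (hσ₃ s hs 0)
  have hH₁0 : ∀ s ∈ Icc t₀ t₁, 0 ≤ H₁ s := fun s hs =>
    (integral_nonneg fun x => sq_nonneg _).trans (hH₁ s hs)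
  have hη₁0 : 0 ≤ D₁ + Ψ₁ := by
    have h1 : 0 ≤ D₁ := (integral_nonneg fun x => frobeniusNormSq_nonneg _).trans hD₁
    have hψ0 : ∀ s ∈ Icc t₀ t₁, 0 ≤ ψ₁ s := fun s hs => by
      refine le_trans ?_ (hψ₁ s hs)
      have : 0 ≤ ∫ x, ‖f s x - g s x‖ ^ 2 := integral_nonneg fun x => sq_nonneg _
      have := hσ₂0 s hs
      positivity
    have h2 : 0 ≤ Ψ₁ := (intervalIntegral.integral_nonneg ht₀₁.le hψ0).trans hΨ₁
    exact add_nonneg h1 h2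
  have hX₁0 : ∀ s ∈ Icc t₀ t₁, 0 ≤ X₁ s := fun s hs =>
    le_trans (by positivity) (hX₁ s hs)
  have hη₂0 : 0 ≤ D₂ + Ψ₂ := by
    have h1 : 0 ≤ D₂ :=
      (Finset.sum_nonneg fun i _ => integral_nonneg fun x => frobeniusNormSq_nonneg _).trans hD₂
    have hψ0 : ∀ s ∈ Icc t₀ t₁, 0 ≤ ψ₂ s := fun s hs => by
      refine le_trans ?_ (hψ₂ s hs)
      have := hσ₂0 s hs; have := hσ₃0 s hs; have := hX₁0 s hs; have := hH₁0 s hs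
      positivity
    have h2 : 0 ≤ Ψ₂ := (intervalIntegral.integral_nonneg ht₀₁.le hψ0).trans hΨ₂
    exact add_nonneg h1 h2
  -- strict smallness and the `X₁` domination of the exact `H¹` bound
  have hsmall₁ : c₁ * (D₁ + Ψ₁) ^ 2 * (t₁ - t₀) < 1 := hhalf₁.trans_lt (by norm_num)
  have hsmall₂ : c₂ * (D₂ + Ψ₂) * (t₁ - t₀) < 1 := hhalf₂.trans_lt (by norm_num)
  have hdom : ∀ s ∈ Icc t₀ t₁,
      Real.exp (∫ r in t₀..s, (4 * G r + 3 * κ * σ₂ r)) * (D₁ + Ψ₁) /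
        Real.sqrt (1 - c₁ * (D₁ + Ψ₁) ^ 2 * (s - t₀)) ≤ X₁ s := by
    intro s hs
    refine le_trans ?_ (hX₁ s hs)
    have hden : 1 / 2 ≤ 1 - c₁ * (D₁ + Ψ₁) ^ 2 * (s - t₀) := by
      have : c₁ * (D₁ + Ψ₁) ^ 2 * (s - t₀) ≤ c₁ * (D₁ + Ψ₁) ^ 2 * (t₁ - t₀) :=
        mul_le_mul_of_nonneg_left (sub_le_sub_right hs.2 _) (by positivity)
      linarith
    have hsq : Real.sqrt (1 / 2) ≤ Real.sqrt (1 - c₁ * (D₁ + Ψ₁) ^ 2 * (s - t₀)) :=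
      Real.sqrt_le_sqrt hden
    have hhalf : 0 < Real.sqrt (1 / 2) := Real.sqrt_pos.2 (by norm_num)
    have hnum : 0 ≤ Real.exp (∫ r in t₀..s, (4 * G r + 3 * κ * σ₂ r)) * (D₁ + Ψ₁) := by positivity
    calc Real.exp (∫ r in t₀..s, (4 * G r + 3 * κ * σ₂ r)) * (D₁ + Ψ₁) /
          Real.sqrt (1 - c₁ * (D₁ + Ψ₁) ^ 2 * (s - t₀))
        ≤ Real.exp (∫ r in t₀..s, (4 * G r + 3 * κ * σ₂ r)) * (D₁ + Ψ₁) / Real.sqrt (1 / 2) :=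
          div_le_div_of_nonneg_left hnum hhalf hsq
      _ = Real.sqrt 2 * (Real.exp (∫ r in t₀..s, (4 * G r + 3 * κ * σ₂ r)) * (D₁ + Ψ₁)) := by
          have h2 : Real.sqrt (1 / 2) = 1 / Real.sqrt 2 := by
            rw [Real.sqrt_div' _ (by norm_num : (0 : ℝ) ≤ 2), Real.sqrt_one]
          rw [h2]
          field_simp
  -- the packaged door
  have key := classicalNS_norm_sub_le_strain_window_of_agmonBound hAg hν ht₀₁ hv hu hU hUt hp hV hVt hq hfD hgD hκ hμ hG
    hσ₂ hσ₃ hL hH₁ hψ₁ hψ₂ hGc hσ₂c hσ₃c hLc hX₁c hH₁c hψ₁c hψ₂c hD₁ hΨ₁ hD₂ hΨ₂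
    (by rw [← hc₁]; exact hsmall₁) (fun s hs => by rw [← hc₁]; exact hdom s hs)
    (by rw [← hc₂]; exact hsmall₂) ht x
  rw [← hc₂] at key
  refine key.trans (mul_le_mul_of_nonneg_left (Real.rpow_le_rpow ?_ ?_ (by norm_num)) hA0)
  · -- nonnegativity of the exact base
    have hden : 0 < 1 - c₂ * (D₂ + Ψ₂) * (t - t₀) := by
      have : c₂ * (D₂ + Ψ₂) * (t - t₀) ≤ c₂ * (D₂ + Ψ₂) * (t₁ - t₀) :=
        mul_le_mul_of_nonneg_left (sub_le_sub_right ht.2 _) (by positivity)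
      linarith
    have := hX₁0 t ht
    positivity
  · -- `1/(1 − c₂η₂(t − t₀)) ≤ 2`
    have hden : 1 / 2 ≤ 1 - c₂ * (D₂ + Ψ₂) * (t - t₀) := by
      have : c₂ * (D₂ + Ψ₂) * (t - t₀) ≤ c₂ * (D₂ + Ψ₂) * (t₁ - t₀) :=
        mul_le_mul_of_nonneg_left (sub_le_sub_right ht.2 _) (by positivity)
      linarith
    have hnum : 0 ≤ Real.exp (∫ s in t₀..t, (6 * G s + 9 * κ * σ₂ s + 3 * κ ^ 2 * σ₃ s +
        3 * A ^ 2 * X₁ s / (ν * μ) + 27 * A ^ 4 * X₁ s ^ 2 / (16 * ν ^ 3))) *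
        (D₂ + Ψ₂) := by positivity
    refine mul_le_mul_of_nonneg_left ?_ (by have := hX₁0 t ht; positivity)
    calc Real.exp (∫ s in t₀..t, (6 * G s + 9 * κ * σ₂ s + 3 * κ ^ 2 * σ₃ s +
            3 * A ^ 2 * X₁ s / (ν * μ) + 27 * A ^ 4 * X₁ s ^ 2 / (16 * ν ^ 3))) *
            (D₂ + Ψ₂) / (1 - c₂ * (D₂ + Ψ₂) * (t - t₀))
        ≤ Real.exp (∫ s in t₀..t, (6 * G s + 9 * κ * σ₂ s + 3 * κ ^ 2 * σ₃ s +
            3 * A ^ 2 * X₁ s / (ν * μ) + 27 * A ^ 4 * X₁ s ^ 2 / (16 * ν ^ 3))) *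
            (D₂ + Ψ₂) / (1 / 2) := div_le_div_of_nonneg_left hnum (by norm_num) hden
      _ = 2 * (Real.exp (∫ s in t₀..t, (6 * G s + 9 * κ * σ₂ s + 3 * κ ^ 2 * σ₃ s +
            3 * A ^ 2 * X₁ s / (ν * μ) + 27 * A ^ 4 * X₁ s ^ 2 / (16 * ν ^ 3))) *
            (D₂ + Ψ₂)) := by ring

end SupDoorSimple

end Literature.Analysis.FluidPDE
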